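import Literature.NumberTheory.GaussSums.JacobiBinomialCongruence
import Literature.NumberTheory.DiophantineGeometry.CatalanJacobiSum
import Literature.NumberTheory.EllipticCurves.PointCountHasseInvariantProofs
import Mathlib.Data.Nat.Prime.Int
import Mathlib.Algebra.Order.Ring.Abs
import Mathlib.Tactic.LinearCombination
import Mathlib.Tactic.Linarith
import Mathlib
import HarnessLib

/-!
# Discharge of `CosgraveDilcher2010_1_6_unique` (uniqueness of `r` in Cosgrave–Dilcher (1.6))

`Literature.NumberTheory.GaussSums.CosgraveDilcher2010_1_6_unique` (file
`JacobiBinomialCongruence.lean`) transcribes Cosgrave–Dilcher, Acta Arith. 142 (2010), p. 104: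
for a prime `p ≡ 1 (mod 6)`, in `4p = r² + 3s²` with `r ≡ 1 (mod 3)`, `s ≡ 0 (mod 3)` "the
integer `r` is then uniquely determined". The paper prints no proof (it refers to
Berndt–Evans–Williams p. 291); Ireland–Rosen state it as Prop. 8.3.2 / Ch. 8 §3 Theorem 2
(`4p = A² + 27B²`, "if we require that `A ≡ 1 (3)`, `A` is uniquely determined") and leave the
uniqueness to Ch. 8 Exercise 13 (hint: unique factorisation in `ℤ[ω]`).

Here it is PROVED, by the classical elementary composition argument for the form `x² + 3y²`
(the norm-multiplicativity of `ℤ[√-3]` written out as polynomial identities, so that nothing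
beyond `linear_combination` / `nlinarith` / `omega` is needed):

* from `4p = a² + 3b² = c² + 3d²`: `3(ad - bc)(ad + bc) = 4p(a² - c²)` and the Brahmagupta
  identities `(ac ± 3bd)² + 3(ad ∓ bc)² = 16p²`, whence `3(ad ∓ bc)² ≤ 16p²`;
* `p` is prime and `p ∤ 3`, so `p ∣ ad - bc` or `p ∣ ad + bc`; as `3 ∣ b` and `3 ∣ d` also
  `3 ∣ ad ∓ bc`, so `3p` divides that factor, and a nonzero multiple `Y` of `3p` would have
  `3Y² ≥ 27p² > 16p²` — so the factor vanishes, hence `4p(a² - c²) = 0`, i.e. `a² = c²`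
  (`sq_eq_sq_of_four_p_repr`; with `b = 3b'`, `d = 3d'` the bookkeeping is done on
  `Y = ad' ∓ b'c`, `27Y² ≤ 16p²`);
* `c = -a` is incompatible with `a ≡ c ≡ 1 (mod 3)`, so `c = a`
  (`CosgraveDilcher2010_1_6_unique_holds`).

## References

* [CosgraveDilcher2010] J. B. Cosgrave, K. Dilcher, *Mod p³ analogues of theorems of Gauss and
  Jacobi on binomial coefficients*, Acta Arith. 142 (2010) 103–118: (1.6), p. 104 — held copy.
* [IrelandRosen1990] K. Ireland, M. Rosen, *A Classical Introduction to Modern Number Theory*,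
  GTM 84: Ch. 8 §3 Prop. 8.3.2 and Theorem 2 (PDF pp. 104–105), Ch. 8 Exercise 13 (PDF p. 114)
  — held copy.
-/

namespace Literature.NumberTheory.GaussSums

/-- Core of the uniqueness: two representations `4p = a² + 3b² = c² + 3d²` with `3 ∣ b`, `3 ∣ d`
(`p` prime, `p ≠ 3`) have `a² = c²` (elementary composition of `x² + 3y²`; Ireland–Rosen obtain
it from unique factorisation in `ℤ[ω]`).
[cite: IrelandRosen1990, Ch. 8 §3 Prop. 8.3.2 (uniqueness up to sign), Ch. 8 Exercise 13] -/
theorem sq_eq_sq_of_four_p_repr {p : ℕ} (hp : p.Prime) (hp3 : p ≠ 3) {a b c d : ℤ}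
    (h1 : 4 * (p : ℤ) = a ^ 2 + 3 * b ^ 2) (h2 : 4 * (p : ℤ) = c ^ 2 + 3 * d ^ 2)
    (hb : 3 ∣ b) (hd : 3 ∣ d) : a ^ 2 = c ^ 2 := by
  obtain ⟨b, rfl⟩ := hb
  obtain ⟨d, rfl⟩ := hd
  have hp0 : (0 : ℤ) < p := by exact_mod_cast hp.pos
  have hpZ : Prime (p : ℤ) := Nat.prime_iff_prime_int.mp hp
  have hp3' : ¬ (p : ℤ) ∣ 3 := by
    intro h
    have h' : p ∣ 3 := by exact_mod_cast h
    exact hp3 ((Nat.prime_dvd_prime_iff_eq hp Nat.prime_three).mp h')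
  have hdvd3 : ∀ z : ℤ, (p : ℤ) ∣ 3 * z → (p : ℤ) ∣ z := fun z hz =>
    (hpZ.dvd_or_dvd hz).resolve_left hp3'
  -- (i) the product identity and the two Brahmagupta identities
  have key : 27 * ((a * d - b * c) * (a * d + b * c)) = 4 * (p : ℤ) * (a ^ 2 - c ^ 2) := by
    linear_combination c ^ 2 * h1 - a ^ 2 * h2
  have brah1 : (a * c + 27 * b * d) ^ 2 + 27 * (a * d - b * c) ^ 2 = 16 * (p : ℤ) ^ 2 := by
    linear_combination (-(c ^ 2 + 27 * d ^ 2)) * h1 - 4 * (p : ℤ) * h2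
  have brah2 : (a * c - 27 * b * d) ^ 2 + 27 * (a * d + b * c) ^ 2 = 16 * (p : ℤ) ^ 2 := by
    linear_combination (-(c ^ 2 + 27 * d ^ 2)) * h1 - 4 * (p : ℤ) * h2
  have bd1 : 27 * (a * d - b * c) ^ 2 ≤ 16 * (p : ℤ) ^ 2 := by
    nlinarith [sq_nonneg (a * c + 27 * b * d)]
  have bd2 : 27 * (a * d + b * c) ^ 2 ≤ 16 * (p : ℤ) ^ 2 := by
    nlinarith [sq_nonneg (a * c - 27 * b * d)]
  -- (ii) `p` divides one of the two factors
  have hpY : (p : ℤ) ∣ (a * d - b * c) * (a * d + b * c) := by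
    apply hdvd3; apply hdvd3; apply hdvd3
    exact ⟨4 * (a ^ 2 - c ^ 2), by linear_combination key⟩
  -- (iii) a multiple `Y` of `p` with `27 Y² ≤ 16 p²` vanishes
  have vanish : ∀ Y : ℤ, (p : ℤ) ∣ Y → 27 * Y ^ 2 ≤ 16 * (p : ℤ) ^ 2 → Y = 0 := by
    intro Y hY hle
    obtain ⟨m, rfl⟩ := hY
    by_contra hne
    have hm : m ≠ 0 := by
      rintro rfl
      simp at hne
    have hm2 : 1 ≤ m ^ 2 := (one_le_sq_iff_one_le_abs m).mpr (Int.one_le_abs hm)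
    nlinarith [mul_le_mul_of_nonneg_left hm2 (sq_nonneg (p : ℤ)), pow_pos hp0 2]
  have hY : a * d - b * c = 0 ∨ a * d + b * c = 0 := by
    rcases hpZ.dvd_or_dvd hpY with h | h
    · exact Or.inl (vanish _ h bd1)
    · exact Or.inr (vanish _ h bd2)
  -- (iv) hence `4p (a² - c²) = 0`
  have h0 : 4 * (p : ℤ) * (a ^ 2 - c ^ 2) = 0 := by
    rw [← key]
    rcases hY with h | h <;> simp [h]
  have hp4 : (4 * (p : ℤ)) ≠ 0 := (by linarith : (0 : ℤ) < 4 * p).ne'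
  have := (mul_eq_zero.mp h0).resolve_left hp4
  linarith

/-- **Discharge** of `CosgraveDilcher2010_1_6_unique`: for a prime `p ≡ 1 (mod 6)`, in
`4p = r² + 3s²` with `r ≡ 1 (mod 3)`, `s ≡ 0 (mod 3)` the integer `r` is uniquely determined
(Cosgrave–Dilcher 2010, (1.6) p. 104; Ireland–Rosen 1990, Ch. 8 §3 Prop. 8.3.2 / Theorem 2,
Exercise 13). Proof: `sq_eq_sq_of_four_p_repr` gives `r² = r'²`, and `r' = -r` contradicts
`r ≡ r' ≡ 1 (mod 3)`. [cite: CosgraveDilcher2010, (1.6) p. 104] -/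
theorem CosgraveDilcher2010_1_6_unique_holds : CosgraveDilcher2010_1_6_unique := by
  intro p r s r' s' hp hp6 h1 hr hs h2 hr' hs'
  have hp3 : p ≠ 3 := by omega
  have hsq : r ^ 2 = r' ^ 2 :=
    sq_eq_sq_of_four_p_repr hp hp3 h1 h2 (Int.dvd_of_emod_eq_zero hs)
      (Int.dvd_of_emod_eq_zero hs')
  have hprod : (r' - r) * (r' + r) = 0 := by linear_combination (-1 : ℤ) * hsq
  rcases mul_eq_zero.mp hprod with h | h
  · linarith
  · exfalso
    have h' : r' = -r := by linarith
    omega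

/-!
## §2 Discharge of `Jacobi1837_binomial` (Cosgrave–Dilcher Thm 4 = Jacobi 1837)

Appended 2026-08-15 (D-0014 append protocol; §1 above is unchanged). Cosgrave–Dilcher, p. 104,
Theorem 4 with (1.6)–(1.7): `C(2(p-1)/3, (p-1)/3) ≡ -r (mod p)`; the paper quotes it from
Berndt–Evans–Williams, *Gauss and Jacobi Sums* (1998), p. 291, without proof. The proof below is
the classical one (Ireland–Rosen Ch. 8 §3, Props. 8.3.3–8.3.4 with Corollary, and the
Jacobi–Cauchy–Kummer congruence `J(ω̄ᵐ, ω̄ⁿ) ≡ -(m+n)!/(m! n!) (P)`, Ch. 14 Exercise 1(a) and the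
remark on PDF pp. 224–225), arranged so that all that is used about `ℤ[ω]` is that
`R₀ = ℤ[X]/(X² + X + 1)` (`AdjoinRoot (cyclotomic 3 ℤ)`) is a domain whose elements are `c + dω`.
With `k = (p-1)/3` (even), `g` a generator of `𝔽_pˣ`, `χ₀ : 𝔽_p → R₀` the cubic character with
`χ₀(g) = ω` (Mathlib's `MulChar.ofRootOfUnity`): (1) `J(χ₀, χ₀) = a + bω`, `a ≡ -1`, `b ≡ 0 (mod 3)`
(IR Prop. 8.3.4; Mathlib's `exists_jacobiSum_eq_neg_one_add`); (2) `J(χ₀⁻¹, χ₀⁻¹) = a + bω²` (via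
`ω ↦ ω²`), so `J J' = a² - ab + b²` in `R₀`, and under `ω ↦ e^{2πi/3}` Mathlib's
`jacobiSum_mul_jacobiSum_inv` (`J J' = p` in `ℂ`) gives `a² - ab + b² = p`, i.e.
`4p = (2a-b)² + 3b²` (IR Prop. 8.3.3, Corollary to 8.3.4); (3) under `ω ↦ ζ^i`, `ζ = g^k ∈ 𝔽_p`,
`i = 1, 2`, the character becomes `x ↦ x^{ik}` and `a + bζ^i = Σ_x x^{ik}(1-x)^{ik}`, which is
`0` for `i = 1` (the tree's `DiophantineGeometry.Catalan.sum_pow_mul_one_sub_pow_eq_zero`) and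
`-C(2k, k)` for `i = 2` (`sum_pow_mul_pow_eq_neg_choose`, via the tree's
`EllipticCurves.sum_pow_eq_ite`); adding, `2a - b ≡ -C(2k, k) (mod p)` (`exists_primary_repr`);
(4) `(2a - b, b)` satisfies (1.6), so `r = 2a - b` by §1. (`exists_primary_repr` also yields
Gauss's `4p = A² + 27B²` with `A = 2a - b ≡ 1 (mod 3)`, `B = b/3`, Ireland–Rosen Prop. 8.3.2 and
Corollary — the statement of the named fact `IrelandRosen1990_four_p_eq_sq_add_27_sq` of
`JacobiBinomialCubic.lean`.)
Sources read 2026-08-15 (both held): [CosgraveDilcher2010] p. 104; [IrelandRosen1990] Ch. 8 §3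
(PDF pp. 104–106), Ch. 14 Ex. 1(a) (PDF p. 225).
-/

open Polynomial Finset

/-! ### §2.1 The binomial character sum over `ZMod p` -/

section ZModSums

variable {p : ℕ} [hp : Fact p.Prime]

/-- The binomial character sum: for `p - 1 = 3k`, `k` even, `Σ_{x ∈ 𝔽_p} x^{2k}(1-x)^{2k} =
-C(2k,k)` (expand `(1-x)^{2k}`; of the power sums `Σ_x x^{2k+j}`, only `j = k` survives, with
`Σ_x x^{p-1} = -1` — the tree's `EllipticCurves.sum_pow_eq_ite`): the `𝔽_p`-side of the
Jacobi–Cauchy–Kummer congruence. [cite: IrelandRosen1990, Ch. 14 Exercise 1(a) (PDF p. 225)] -/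
private theorem sum_pow_mul_pow_eq_neg_choose {k : ℕ} (hk0 : 0 < k) (hpk : p - 1 = 3 * k)
    (hke : Even k) :
    ∑ x : ZMod p, x ^ (2 * k) * (1 - x) ^ (2 * k) = -((2 * k).choose k : ZMod p) := by
  have hexp : ∀ x : ZMod p, (1 - x) ^ (2 * k)
      = ∑ j ∈ range (2 * k + 1), ((-1 : ZMod p) ^ j * ((2 * k).choose j : ZMod p)) * x ^ j := by
    intro x
    rw [sub_eq_add_neg, add_comm, add_pow]
    refine sum_congr rfl fun j _ => ?_
    rw [one_pow, mul_one, neg_pow]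
    ring
  calc ∑ x : ZMod p, x ^ (2 * k) * (1 - x) ^ (2 * k)
      = ∑ x : ZMod p, ∑ j ∈ range (2 * k + 1),
          ((-1 : ZMod p) ^ j * ((2 * k).choose j : ZMod p)) * x ^ (2 * k + j) := by
        refine sum_congr rfl fun x _ => ?_
        rw [hexp x, Finset.mul_sum]
        refine sum_congr rfl fun j _ => ?_
        rw [pow_add]; ring
    _ = ∑ j ∈ range (2 * k + 1),
          ((-1 : ZMod p) ^ j * ((2 * k).choose j : ZMod p)) * ∑ x : ZMod p, x ^ (2 * k + j) := by
        rw [Finset.sum_comm]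
        exact sum_congr rfl fun j _ => by rw [Finset.mul_sum]
    _ = ((-1 : ZMod p) ^ k * ((2 * k).choose k : ZMod p)) * (-1) := by
        rw [Finset.sum_eq_single_of_mem k (mem_range.mpr (by omega))]
        · rw [EllipticCurves.sum_pow_eq_ite (by rw [ZMod.card]; omega), ZMod.card,
            if_pos (by omega)]
        · intro j hj hjk
          rw [EllipticCurves.sum_pow_eq_ite (by rw [ZMod.card]; have := mem_range.mp hj; omega),
            ZMod.card, if_neg (by omega), mul_zero]
    _ = -((2 * k).choose k : ZMod p) := by rw [hke.neg_one_pow]; ring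

/-- A multiplicative character of `𝔽_p` with values in `𝔽_p` sending a generator `g` of `𝔽_pˣ` to
`g^m` (`m ≥ 1`) is `x ↦ x^m`. [folklore] -/
private theorem apply_eq_pow {g : (ZMod p)ˣ} (hg : ∀ x, x ∈ Subgroup.zpowers g)
    (χ : MulChar (ZMod p) (ZMod p)) {m : ℕ} (hm : m ≠ 0) (hχ : χ g = (g : ZMod p) ^ m)
    (x : ZMod p) : χ x = x ^ m := by
  by_cases hx : x = 0
  · rw [hx, zero_pow hm, MulChar.map_nonunit _ not_isUnit_zero]
  · obtain ⟨n, hn⟩ := (Submonoid.mem_powers_iff _ _).mp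
      (mem_powers_iff_mem_zpowers.mpr (hg (Units.mk0 x hx)))
    have hxn : x = (g : ZMod p) ^ n := by rw [← Units.val_pow_eq_pow_val, hn, Units.val_mk0]
    rw [hxn, map_pow, hχ, ← pow_mul, ← pow_mul, mul_comm]

end ZModSums

/-! ### §2.2 The ring `ℤ[ω] = ℤ[X]/(X² + X + 1)` -/

section EisensteinRing

/-- `Φ₃(t) = t² + t + 1`. [folklore] -/
private theorem eval₂_cyclotomic_three {S : Type*} [CommRing S] (t : S) :
    eval₂ (Int.castRingHom S) t (cyclotomic 3 ℤ) = t ^ 2 + t + 1 := by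
  rw [cyclotomic_three, eval₂_add, eval₂_add, eval₂_X_pow, eval₂_X, eval₂_one]

/-- `ω² + ω + 1 = 0` in `ℤ[ω] = ℤ[X]/(Φ₃)`. [folklore] -/
private theorem root_rel :
    AdjoinRoot.root (cyclotomic 3 ℤ) ^ 2 + AdjoinRoot.root (cyclotomic 3 ℤ) + 1 = 0 := by
  have h := AdjoinRoot.eval₂_root (cyclotomic 3 ℤ)
  rwa [show AdjoinRoot.of (cyclotomic 3 ℤ) = Int.castRingHom _ from RingHom.ext_int _ _,
    eval₂_cyclotomic_three] at h

/-- `ω³ = 1` in `ℤ[ω]`. [folklore] -/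
private theorem root_pow_three : AdjoinRoot.root (cyclotomic 3 ℤ) ^ 3 = 1 := by
  linear_combination (AdjoinRoot.root (cyclotomic 3 ℤ) - 1) * root_rel

/-- `ℤ[ω] = ℤ[X]/(Φ₃)` is an integral domain (`Φ₃` is irreducible, hence prime, in the UFD `ℤ[X]`).
[folklore] -/
private theorem isDomain_adjoinRoot : IsDomain (AdjoinRoot (cyclotomic 3 ℤ)) :=
  AdjoinRoot.isDomain_of_prime
    (UniqueFactorizationMonoid.irreducible_iff_prime.mp (cyclotomic.irreducible (by norm_num)))

/-- Every element of `ℤ[ω]` is `c + dω` with `c d : ℤ`. [folklore] -/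
private theorem exists_int_int (x : AdjoinRoot (cyclotomic 3 ℤ)) :
    ∃ c d : ℤ, x = c + d * AdjoinRoot.root (cyclotomic 3 ℤ) := by
  set ϖ : AdjoinRoot (cyclotomic 3 ℤ) := AdjoinRoot.root (cyclotomic 3 ℤ)
  have hϖrel : ϖ ^ 2 + ϖ + 1 = 0 := root_rel
  obtain ⟨P, rfl⟩ := AdjoinRoot.mk_surjective x
  rw [← AdjoinRoot.aeval_eq]
  induction P using Polynomial.induction_on' with
  | add P Q hP hQ =>
    obtain ⟨c, d, hcd⟩ := hP
    obtain ⟨c', d', hcd'⟩ := hQ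
    exact ⟨c + c', d + d', by rw [map_add, hcd, hcd']; push_cast; ring⟩
  | monomial n c =>
    obtain ⟨e, f, hef⟩ : ∃ e f : ℤ, ϖ ^ n = e + f * ϖ := by
      induction n with
      | zero => exact ⟨1, 0, by simp⟩
      | succ n ih =>
        obtain ⟨e, f, h⟩ := ih
        refine ⟨-f, e - f, ?_⟩
        rw [pow_succ, h]
        push_cast
        linear_combination (f : AdjoinRoot (cyclotomic 3 ℤ)) * hϖrel
    refine ⟨c * e, c * f, ?_⟩
    rw [aeval_monomial, eq_intCast, hef]
    push_cast
    ring

/-! ### §2.3 The cubic Jacobi sum: `4p = (2a-b)² + 3b²` and `C(2k, k) ≡ -(2a - b) (mod p)` -/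

/-- **The cubic Jacobi sum, reduced modulo `p`** (steps (1)–(3) of the §2 doc block): for a prime
`p ≡ 1 (mod 6)`, `k = (p-1)/3`, there are `a ≡ -1`, `b ≡ 0 (mod 3)` with `a² - ab + b² = p`
(`J(χ₀, χ₀) = a + bω`; Ireland–Rosen Props. 8.3.3–8.3.4 and Corollary) and
`C(2k, k) ≡ -(2a - b) (mod p)` (Jacobi–Cauchy–Kummer, summed over the two primes of `ℤ[ω]`
above `p`). [cite: IrelandRosen1990, Ch. 8 §3 Props. 8.3.3–8.3.4, Cor.; Ch. 14 Ex. 1(a)] -/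
private theorem exists_primary_repr (p : ℕ) [Fact p.Prime] (hp6 : p % 6 = 1) :
    ∃ a b : ℤ, a % 3 = 2 ∧ b % 3 = 0 ∧ a ^ 2 - a * b + b ^ 2 = p ∧
      ((Nat.choose (2 * ((p - 1) / 3)) ((p - 1) / 3) : ℕ) : ZMod p) =
        -((2 * a - b : ℤ) : ZMod p) := by
  have hpr : p.Prime := Fact.out
  set ϖ : AdjoinRoot (cyclotomic 3 ℤ) := AdjoinRoot.root (cyclotomic 3 ℤ)
  have hϖrel : ϖ ^ 2 + ϖ + 1 = 0 := root_rel
  have hϖ3 : ϖ ^ 3 = 1 := root_pow_three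
  -- numerology: `p - 1 = 3k`, `k` even and positive
  set k := (p - 1) / 3 with hk
  have hp7 : 7 ≤ p := by have := hpr.two_le; omega
  have hpk : p - 1 = 3 * k := by omega
  have hk0 : 0 < k := by omega
  have hke : Even k := ⟨p / 6, by omega⟩
  -- a generator `g` of `𝔽_pˣ` and the cube root of unity `ζ = g^k ∈ 𝔽_p`
  obtain ⟨g, hg⟩ := IsCyclic.exists_generator (α := (ZMod p)ˣ)
  have hgord : orderOf g = p - 1 := by
    rw [orderOf_eq_card_of_forall_mem_zpowers hg, Nat.card_eq_fintype_card, ZMod.card_units]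
  have hgprim : IsPrimitiveRoot (g : ZMod p) (p - 1) :=
    IsPrimitiveRoot.coe_units_iff.mpr (hgord ▸ IsPrimitiveRoot.orderOf g)
  set ζ : ZMod p := (g : ZMod p) ^ k with hζ
  have hζprim : IsPrimitiveRoot ζ 3 := hgprim.pow (by omega) (by omega)
  have hζrel : ζ ^ 2 + ζ + 1 = 0 := by
    have h := hζprim.isRoot_cyclotomic (by norm_num)
    rwa [IsRoot.def, cyclotomic_three, eval_add, eval_add, eval_pow, eval_X, eval_one] at h
  have hζrel2 : (ζ ^ 2) ^ 2 + ζ ^ 2 + 1 = 0 := by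
    linear_combination (ζ ^ 2 - ζ + 1) * hζrel
  -- `ω = e^{2πi/3} ∈ ℂ` and `φC : ℤ[ω] → ℂ`
  set ω : ℂ := Complex.exp (2 * Real.pi * Complex.I / 3) with hωdef
  have hω : IsPrimitiveRoot ω 3 := by
    rw [hωdef]; exact_mod_cast Complex.isPrimitiveRoot_exp 3 (by norm_num)
  have hωrel : ω ^ 2 + ω + 1 = 0 := by
    have h := hω.isRoot_cyclotomic (by norm_num)
    rwa [IsRoot.def, cyclotomic_three, eval_add, eval_add, eval_pow, eval_X, eval_one] at h
  let φC : AdjoinRoot (cyclotomic 3 ℤ) →+* ℂ :=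
    AdjoinRoot.lift (Int.castRingHom ℂ) ω (by rw [eval₂_cyclotomic_three]; exact hωrel)
  have hφCϖ : φC ϖ = ω := AdjoinRoot.lift_root _
  have hϖprim : IsPrimitiveRoot ϖ 3 :=
    IsPrimitiveRoot.mk_of_lt ϖ (by norm_num) hϖ3 fun l hl0 hl3 hl => by
      apply hω.pow_ne_one_of_pos_of_lt hl0.ne' hl3
      rw [← hφCϖ, ← map_pow, hl, map_one]
  -- the cubic character `χ₀ : 𝔽_p → ℤ[ω]` with `χ₀(g) = ω`
  haveI : IsDomain (AdjoinRoot (cyclotomic 3 ℤ)) := isDomain_adjoinRoot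
  let ϖu : (AdjoinRoot (cyclotomic 3 ℤ))ˣ :=
    Units.mkOfMulEqOne ϖ (ϖ ^ 2) (by rw [← pow_succ', hϖ3])
  have hϖu : ϖu ∈ rootsOfUnity (Fintype.card (ZMod p)ˣ) (AdjoinRoot (cyclotomic 3 ℤ)) := by
    rw [mem_rootsOfUnity, Units.ext_iff, Units.val_pow_eq_pow_val, ZMod.card_units, hpk, pow_mul,
      Units.val_one, Units.val_mkOfMulEqOne, hϖ3, one_pow]
  set χ₀ : MulChar (ZMod p) (AdjoinRoot (cyclotomic 3 ℤ)) := MulChar.ofRootOfUnity hϖu hg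
    with hχ₀def
  have hχ₀g : χ₀ g = ϖ := by rw [hχ₀def, MulChar.ofRootOfUnity_spec]; rfl
  have hχ₀3 : χ₀ ^ 3 = 1 := by
    rw [MulChar.eq_iff hg, MulChar.pow_apply_coe, MulChar.one_apply_coe, hχ₀g, hϖ3]
  -- `J(χ₀, χ₀) = a + bω` with `a ≡ -1`, `b ≡ 0 (mod 3)` (Ireland–Rosen Prop. 8.3.4)
  obtain ⟨a, b, ha3, hb3, hJ⟩ : ∃ a b : ℤ, a % 3 = 2 ∧ b % 3 = 0 ∧
      jacobiSum χ₀ χ₀ = a + b * ϖ := by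
    obtain ⟨z, -, hz⟩ := exists_jacobiSum_eq_neg_one_add (by norm_num : 2 < 3) hχ₀3 hχ₀3
      (by rw [ZMod.card, hpk]; exact dvd_mul_right 3 k) hϖprim
    obtain ⟨c, d, rfl⟩ := exists_int_int z
    refine ⟨-1 + 3 * d, 3 * (d - c), by omega, by omega, ?_⟩
    rw [hz]
    push_cast
    linear_combination ((c : AdjoinRoot (cyclotomic 3 ℤ)) + d * (ϖ - 3)) * hϖrel
  -- `J(χ₀⁻¹, χ₀⁻¹) = a + bω²` via the automorphism `ω ↦ ω²`, and the norm `J J' = a² - ab + b²`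
  let σ : AdjoinRoot (cyclotomic 3 ℤ) →+* AdjoinRoot (cyclotomic 3 ℤ) :=
    AdjoinRoot.lift (Int.castRingHom _) (ϖ ^ 2)
      (by rw [eval₂_cyclotomic_three]; linear_combination (ϖ ^ 2 - ϖ + 1) * hϖrel)
  have hσϖ : σ ϖ = ϖ ^ 2 := AdjoinRoot.lift_root _
  have hχinv : χ₀⁻¹ = χ₀.ringHomComp σ := by
    have h2 : χ₀⁻¹ = χ₀ ^ 2 := inv_eq_of_mul_eq_one_right (by rw [← pow_succ', hχ₀3])
    rw [h2, MulChar.eq_iff hg, MulChar.pow_apply_coe, MulChar.ringHomComp_apply, hχ₀g, hσϖ]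
  have hJ' : jacobiSum χ₀⁻¹ χ₀⁻¹ = a + b * ϖ ^ 2 := by
    rw [hχinv, jacobiSum_ringHomComp, hJ, map_add, map_mul, map_intCast, map_intCast, hσϖ]
  have hnormR : jacobiSum χ₀ χ₀ * jacobiSum χ₀⁻¹ χ₀⁻¹ =
      ((a ^ 2 - a * b + b ^ 2 : ℤ) : AdjoinRoot (cyclotomic 3 ℤ)) := by
    rw [hJ, hJ']
    push_cast
    linear_combination ((a : AdjoinRoot (cyclotomic 3 ℤ)) * b + (b : _) ^ 2 * (ϖ - 1)) * hϖrel
  -- in `ℂ`: `J J' = p` (Mathlib's `jacobiSum_mul_jacobiSum_inv`), so `a² - ab + b² = p`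
  have hN : (a ^ 2 - a * b + b ^ 2 : ℤ) = p := by
    set χC : MulChar (ZMod p) ℂ := χ₀.ringHomComp φC with hχCdef
    have hχCg : χC g = ω := by rw [hχCdef, MulChar.ringHomComp_apply, hχ₀g, hφCϖ]
    have hχC1 : χC ≠ 1 := by
      intro h
      have h' := congrArg (fun χ : MulChar (ZMod p) ℂ => χ (g : ZMod p)) h
      simp only [hχCg, MulChar.one_apply_coe] at h'
      exact hω.ne_one (by norm_num) h'
    have hχC2 : χC * χC ≠ 1 := by
      intro h
      have h' : (χC * χC) (g : ZMod p) = (1 : MulChar (ZMod p) ℂ) (g : ZMod p) := by rw [h]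
      rw [MulChar.mul_apply, hχCg, MulChar.one_apply_coe, ← pow_two] at h'
      exact hω.pow_ne_one_of_pos_of_lt (by norm_num : (2 : ℕ) ≠ 0) (by norm_num) h'
    have hchar : ringChar ℂ ≠ ringChar (ZMod p) := by
      rw [ringChar.eq_zero, ZMod.ringChar_zmod_n]; exact hpr.ne_zero.symm
    have hC := jacobiSum_mul_jacobiSum_inv hchar hχC1 hχC1 hχC2
    rw [hχCdef, MulChar.ringHomComp_inv, jacobiSum_ringHomComp, jacobiSum_ringHomComp,
      ← map_mul, hnormR, map_intCast, ZMod.card] at hC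
    exact_mod_cast hC
  -- in `𝔽_p`: under `ω ↦ t = g^m` (`t = ζ, ζ²`, `m = k, 2k`), `χ₀ ↦ (x ↦ x^m)` and
  -- `a + b t = Σ_x x^m (1 - x)^m`
  have hred : ∀ (t : ZMod p), t ^ 2 + t + 1 = 0 → ∀ (m : ℕ), m ≠ 0 → t = (g : ZMod p) ^ m →
      (a : ZMod p) + b * t = ∑ x : ZMod p, x ^ m * (1 - x) ^ m := by
    intro t ht m hm htg
    let φ : AdjoinRoot (cyclotomic 3 ℤ) →+* ZMod p :=
      AdjoinRoot.lift (Int.castRingHom (ZMod p)) t (by rw [eval₂_cyclotomic_three]; exact ht)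
    have hφϖ : φ ϖ = t := AdjoinRoot.lift_root _
    have hχφ : ∀ x, φ (χ₀ x) = x ^ m := fun x => by
      rw [← MulChar.ringHomComp_apply]
      exact apply_eq_pow hg _ hm (by rw [MulChar.ringHomComp_apply, hχ₀g, hφϖ, htg]) x
    have h := congrArg φ hJ
    rw [map_add, map_mul, map_intCast, map_intCast, hφϖ] at h
    rw [← h, jacobiSum, map_sum]
    exact sum_congr rfl fun x _ => by rw [map_mul, hχφ, hχφ]
  have h1 := hred ζ hζrel k hk0.ne' rfl
  have h2 := hred (ζ ^ 2) hζrel2 (2 * k) (by omega) (by rw [hζ, ← pow_mul, mul_comm])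
  rw [DiophantineGeometry.Catalan.sum_pow_mul_one_sub_pow_eq_zero (by rw [ZMod.card]; omega)] at h1
  rw [sum_pow_mul_pow_eq_neg_choose hk0 hpk hke] at h2
  have hcong : (((2 * k).choose k : ℕ) : ZMod p) = -(((2 * a - b : ℤ)) : ZMod p) := by
    push_cast
    linear_combination h1 + h2 - (b : ZMod p) * hζrel
  exact ⟨a, b, ha3, hb3, hN, hcong⟩

end EisensteinRing

/-! ### §2.4 The discharge -/

/-- **Jacobi's theorem (1837)**, Cosgrave–Dilcher Theorem 4 / (1.7): for a prime `p ≡ 1 (mod 6)`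
and `4p = r² + 3s²` with `r ≡ 1 (mod 3)`, `s ≡ 0 (mod 3)`,
`C(2(p-1)/3, (p-1)/3) ≡ -r (mod p)`. Discharges `Jacobi1837_binomial`: `(2a - b, b)` of
`exists_primary_repr` satisfies (1.6) with `C(2k, k) ≡ -(2a - b)`, and `r = 2a - b` by §1.
[cite: CosgraveDilcher2010, Thm 4 (1.7) p. 104] -/
theorem Jacobi1837_binomial_holds : Jacobi1837_binomial := by
  intro p r s hpr hp6 h4p hr3 hs3
  haveI : Fact p.Prime := ⟨hpr⟩
  obtain ⟨a, b, ha3, hb3, hN, hcong⟩ := exists_primary_repr p hp6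
  have h4p' : 4 * (p : ℤ) = (2 * a - b) ^ 2 + 3 * b ^ 2 := by rw [← hN]; ring
  rw [CosgraveDilcher2010_1_6_unique_holds p (2 * a - b) b r s hpr hp6 h4p' (by omega) (by omega)
    h4p hr3 hs3]
  exact hcong

end Literature.NumberTheory.GaussSums
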